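import Summits.CriticalPhenomena.PercolationContinuityZ3.Theorems.PercNearOneGluingNoHeavyLowerTailAPLLadderNumbers
import Summits.CriticalPhenomena.PercolationContinuityZ3.Theorems.PercNearOneGluingNoHeavyLowerTailGZSPDefs
import HarnessLib

/-!
# `NoHeavyLowerTail` (stmt-CriticalPhenomena-4575) — LADDER NETWORKS III: the pendant apex and membership of the apex ladder in `GZSP.IsSPNet`

Support file (prover prim-ineq-gen-8 gen 61; `--supports stmt-CriticalPhenomena-4575`; memo
run/shared/lean/prim/prim-ineq-gen-8/FINDING-gen61-SPTHEOREM.md §2).  No definitions, no named facts, no sorries.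

Setting of `…APLLadderCells` / `…APLLadderNumbers`: weights `p` on `Sym2 V`, `DecisionTree.PrW`, clusters `Gladkov.cl`; the balanced ladder
`L n` on the vertices `z 0, …, z(2n+2)` (a hypothesis `hL0`/`hLs`, instantiated by recursion in `…APLLadderSharpness`), and the APEX LADDER
`insert s(o, z 0) (L n)`: the apex `o` hangs at the attachment vertex `z 0` by a single edge; ports `z(2n+1), z(2n+2)`.
* **`pendant_apex_numbers`** — a pendant apex sees the core only through its attachment vertex `g`: the four numbers of `(o; u, v)` on
  `insert s(o,g) R` are `(ε p_g, ε π_g, ε τ_g, m_g + τ_g − ε τ_g)`, `ε` the weight of `s(o,g)`, in terms of the numbers of `(g; u, v)` on the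
  core `R` (pendant lemmas `pendant_cell_*` of `…APLPendantCells`); hence `E(o; u, v) → τ_g²/(p_g π_g (m_g + τ_g))` as `ε → 0` — the
  weak-apex ("DV²") limit of memo gen 57, now for an arbitrary core.
* **`ladder_isSPNet`** — the apex ladder is a two-terminal series–parallel apex network in the reviewed syntax `GZSP.IsSPNet` of
  `…LowerTailGZSPDefs` (edge `z1 z0`, hub edge at `z0`, series with `z0 z2` at `z0`; per round: a parallel rung, a series rail at each port),
  with the bookkeeping `ladder_vertex` / `ladder_rung_fresh` of `…APLLadderNumbers`.
The sharpness theorem itself (`sp_E_le_sharp`: `E > 28/27 − δ` on a balanced apex ladder) is `…APLLadderSharpness`. [this work]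
-/

namespace Summit.CriticalPhenomena.PercolationContinuityZ3.Theorems

namespace APL

open Literature.Probability.Percolation Literature.Probability.Percolation.Gladkov Literature.Probability.Percolation.DecisionTree
open scoped Classical

variable {V : Type*} [Fintype V]

/-! ### A pendant apex: the network's numbers are `ε`-scalings of the core's three-point numbers -/

/-- **Pendant apex.**  If the apex `o` is joined to the core `R` (`o` off `R`) by the single edge `s(o, g)` of weight `ε`, then for ports
`u, v ≠ o` the four numbers of `(o; u, v)` on `insert s(o,g) R` are `ε·p_g`, `ε·π_g`, `ε·τ_g` and `m_g + τ_g − ε·τ_g`, where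
`(p_g, π_g, τ_g, m_g)` are the numbers of `(g; u, v)` on the core `R` (pendant lemmas `pendant_cell_*`).  In particular
`E(o; u, v) → τ_g²/(p_g π_g (m_g + τ_g))` as `ε → 0` (the "DV²" limit of memo gen 57). [this work] -/
theorem pendant_apex_numbers (p : Sym2 V → ℝ) (R : Finset (Sym2 V)) (o g u v : V) (hog : o ≠ g) (huo : u ≠ o) (hvo : v ≠ o)
    (hR : ∀ f ∈ R, o ∉ f) :
    PrW (insert s(o, g) R) p {K : Finset (Sym2 V) | u ∈ cl K o} = p s(o, g) * PrW R p {K : Finset (Sym2 V) | u ∈ cl K g}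
    ∧ PrW (insert s(o, g) R) p {K : Finset (Sym2 V) | v ∈ cl K o} = p s(o, g) * PrW R p {K : Finset (Sym2 V) | v ∈ cl K g}
    ∧ PrW (insert s(o, g) R) p {K : Finset (Sym2 V) | u ∈ cl K o ∧ v ∈ cl K o}
        = p s(o, g) * PrW R p {K : Finset (Sym2 V) | u ∈ cl K g ∧ v ∈ cl K g}
    ∧ PrW (insert s(o, g) R) p {K : Finset (Sym2 V) | u ∉ cl K o ∧ v ∈ cl K u}
        = PrW R p {K : Finset (Sym2 V) | u ∉ cl K g ∧ v ∈ cl K u} + PrW R p {K : Finset (Sym2 V) | u ∈ cl K g ∧ v ∈ cl K g}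
          - p s(o, g) * PrW R p {K : Finset (Sym2 V) | u ∈ cl K g ∧ v ∈ cl K g} := by
  have he : s(o, g) ∈ insert s(o, g) R := Finset.mem_insert_self _ _
  have hnot : s(o, g) ∉ R := fun h => hR _ h (Sym2.mem_mk_left _ _)
  have hD : ∀ f ∈ insert s(o, g) R, o ∈ f → f = s(o, g) := fun f hf hof => by
    rw [Finset.mem_insert] at hf
    rcases hf with rfl | hf
    · rfl
    · exact absurd hof (hR f hf)
  have hE : (insert s(o, g) R).erase s(o, g) = R := Finset.erase_insert hnot
  have cB := pendant_cell_ab p (insert s(o, g) R) o g u v hog huo hvo he hD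
  have cA := pendant_cell_ac p (insert s(o, g) R) o g u v hog huo hvo he hD
  have cM := pendant_cell_bc p (insert s(o, g) R) o g u v hog huo hvo he hD
  have cT := pendant_cell_three p (insert s(o, g) R) o g u v hog huo hvo he hD
  rw [hE] at cB cA cM cT
  have sv := pendant_split_bc' p R g u v
  rw [conn_eq_cells_b p (insert s(o, g) R) o u v, conn_eq_cells_c p (insert s(o, g) R) o u v,
    m_event_eq_cell p (insert s(o, g) R) o u v, cB, cA, cM, cT, sv,
    conn_eq_cells_b p R g u v, conn_eq_cells_c p R g u v, m_event_eq_cell p R g u v]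
  refine ⟨by ring, by ring, by ring, by ring⟩

/-! ### The apex ladder is a two-terminal series–parallel apex network -/

section Membership

variable (z : ℕ → V) (L : ℕ → Finset (Sym2 V)) (o : V)
  (hL0 : L 0 = {s(z 0, z 1)} ∪ {s(z 0, z 2)})
  (hLs : ∀ r : ℕ, L (r + 1) = ({s(z (2 * r + 3), z (2 * r + 1))} ∪ (L r ∪ {s(z (2 * r + 1), z (2 * r + 2))})) ∪ {s(z (2 * r + 4), z (2 * r + 2))})

include hL0 hLs

omit [Fintype V] in
/-- **The apex ladder is in the class `GZSP.IsSPNet`** (hub = apex `o`, terminals = the last two vertices): built from the edge `z1 z0`, the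
hub edge at `z0`, the edge `z0 z2` (series at `z0`), and then per round a parallel rung and two series rails. [this work] -/
theorem ladder_isSPNet (n : ℕ) (hz : ∀ i j, i ≤ 2 * n + 2 → j ≤ 2 * n + 2 → z i = z j → i = j)
    (ho : ∀ j, j ≤ 2 * n + 2 → z j ≠ o) :
    GZSP.IsSPNet o (insert s(o, z 0) (L n)) (z (2 * n + 1)) (z (2 * n + 2)) := by
  induction n with
  | zero =>
    have h10 : z 1 ≠ z 0 := fun h => by have := hz 1 0 (by omega) (by omega) h; omega
    have h02 : z 0 ≠ z 2 := fun h => by have := hz 0 2 (by omega) (by omega) h; omega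
    have h12 : z 1 ≠ z 2 := fun h => by have := hz 1 2 (by omega) (by omega) h; omega
    have h0o : z 0 ≠ o := ho 0 (by omega)
    have h1o : z 1 ≠ o := ho 1 (by omega)
    have h2o : z 2 ≠ o := ho 2 (by omega)
    have h₁ : GZSP.IsSPNet o (insert s(z 0, o) {s(z 1, z 0)}) (z 1) (z 0) := by
      refine GZSP.IsSPNet.hubRight (GZSP.IsSPNet.edge h10 h1o h0o) ?_
      rw [Finset.mem_singleton, Sym2.eq_iff]
      rintro (⟨h, -⟩ | ⟨-, h⟩)
      · exact h10 h.symm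
      · exact h1o h.symm
    have h₂ : GZSP.IsSPNet o {s(z 0, z 2)} (z 0) (z 2) := GZSP.IsSPNet.edge h02 h0o h2o
    have h₃ := GZSP.IsSPNet.series h₁ h₂ ?_ ?_ ?_ ?_
    · have e : insert s(z 0, o) ({s(z 1, z 0)} : Finset (Sym2 V)) ∪ {s(z 0, z 2)}
          = insert s(o, z 0) (({s(z 0, z 1)} : Finset (Sym2 V)) ∪ {s(z 0, z 2)}) := by
        rw [Sym2.eq_swap (a := z 0) (b := o), Sym2.eq_swap (a := z 1) (b := z 0)]
        ext e
        simp only [Finset.mem_union, Finset.mem_insert, Finset.mem_singleton]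
        tauto
      simpa only [Nat.mul_zero, Nat.zero_add, hL0, e] using h₃
    · rw [Finset.disjoint_singleton_right, Finset.mem_insert, Finset.mem_singleton, not_or, Sym2.eq_iff, Sym2.eq_iff]
      refine ⟨?_, ?_⟩
      · rintro (⟨-, h⟩ | ⟨h, -⟩)
        · exact h2o h
        · exact h0o h
      · rintro (⟨h, -⟩ | ⟨-, h⟩)
        · exact h10 h.symm
        · exact h12 h.symm
    · rintro x ⟨e, he, hxe⟩ ⟨f, hf, hxf⟩
      rw [Finset.mem_singleton] at hf
      subst hf
      rcases Sym2.mem_iff.1 hxf with rfl | rfl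
      · exact Or.inl rfl
      · rw [Finset.mem_insert, Finset.mem_singleton] at he
        rcases he with rfl | rfl
        · rcases Sym2.mem_iff.1 hxe with h | h
          · exact absurd h h02.symm
          · exact Or.inr h
        · rcases Sym2.mem_iff.1 hxe with h | h
          · exact absurd h h12.symm
          · exact absurd h h02.symm
    · intro e he h1
      rw [Finset.mem_singleton] at he
      subst he
      rcases Sym2.mem_iff.1 h1 with h | h
      · exact h10 h
      · exact h12 h
    · intro e he h2
      rw [Finset.mem_insert, Finset.mem_singleton] at he
      rcases he with rfl | rfl
      · rcases Sym2.mem_iff.1 h2 with h | h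
        · exact h02 h.symm
        · exact h2o h
      · rcases Sym2.mem_iff.1 h2 with h | h
        · exact h12 h.symm
        · exact h02 h.symm
  | succ n ih =>
    have h := ih (fun i j hi hj h => hz i j (by omega) (by omega) h) fun j hj => ho j (by omega)
    have hg1 : z (2 * n + 1) ≠ z 0 := fun h => by have := hz _ _ (by omega) (by omega) h; omega
    have h12 : z (2 * n + 1) ≠ z (2 * n + 2) := fun h => by have := hz _ _ (by omega) (by omega) h; omega
    have h31 : z (2 * n + 3) ≠ z (2 * n + 1) := fun h => by have := hz _ _ (by omega) (by omega) h; omega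
    have h32 : z (2 * n + 3) ≠ z (2 * n + 2) := fun h => by have := hz _ _ (by omega) (by omega) h; omega
    have h42 : z (2 * n + 4) ≠ z (2 * n + 2) := fun h => by have := hz _ _ (by omega) (by omega) h; omega
    have h43 : z (2 * n + 4) ≠ z (2 * n + 3) := fun h => by have := hz _ _ (by omega) (by omega) h; omega
    have h1o : z (2 * n + 1) ≠ o := ho _ (by omega)
    have h2o : z (2 * n + 2) ≠ o := ho _ (by omega)
    have h3o : z (2 * n + 3) ≠ o := ho _ (by omega)
    have h4o : z (2 * n + 4) ≠ o := ho _ (by omega)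
    -- vertices of the apex ladder `insert s(o, z 0) (L n)` are `o` or `z j`, `j ≤ 2n+2`
    have hvert : ∀ e ∈ insert s(o, z 0) (L n), ∀ x ∈ e, x = o ∨ ∃ j, j ≤ 2 * n + 2 ∧ x = z j := by
      intro e he x hx
      rw [Finset.mem_insert] at he
      rcases he with rfl | he
      · rcases Sym2.mem_iff.1 hx with rfl | rfl
        · exact Or.inl rfl
        · exact Or.inr ⟨0, by omega, rfl⟩
      · exact Or.inr (ladder_vertex z L hL0 hLs n he hx)
    have hfresh3 : ∀ e ∈ insert s(o, z 0) (L n), z (2 * n + 3) ∉ e := fun e he hx => by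
      rcases hvert e he _ hx with h | ⟨j, hj, h⟩
      · exact h3o h
      · have := hz _ _ (by omega) (by omega) h; omega
    have hfresh4 : ∀ e ∈ insert s(o, z 0) (L n), z (2 * n + 4) ∉ e := fun e he hx => by
      rcases hvert e he _ hx with h | ⟨j, hj, h⟩
      · exact h4o h
      · have := hz _ _ (by omega) (by omega) h; omega
    -- the rung
    have hrung : GZSP.IsSPNet o (insert s(o, z 0) (L n) ∪ {s(z (2 * n + 1), z (2 * n + 2))}) (z (2 * n + 1)) (z (2 * n + 2)) := by
      refine GZSP.IsSPNet.parallel h (GZSP.IsSPNet.edge h12 h1o h2o) ?_ ?_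
      · rw [Finset.disjoint_singleton_right, Finset.mem_insert, not_or]
        refine ⟨fun h => ?_, ladder_rung_fresh z L hL0 hLs n (fun i j hi hj h => hz i j (by omega) (by omega) h)⟩
        rw [Sym2.eq_iff] at h
        rcases h with ⟨h, -⟩ | ⟨-, h⟩
        · exact h1o h
        · exact h2o h
      · rintro x - ⟨f, hf, hxf⟩
        rw [Finset.mem_singleton] at hf
        subst hf
        rcases Sym2.mem_iff.1 hxf with rfl | rfl
        · exact Or.inl rfl
        · exact Or.inr (Or.inl rfl)
    -- the rail at u
    have hrailu : GZSP.IsSPNet o ({s(z (2 * n + 3), z (2 * n + 1))} ∪ (insert s(o, z 0) (L n) ∪ {s(z (2 * n + 1), z (2 * n + 2))}))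
        (z (2 * n + 3)) (z (2 * n + 2)) := by
      refine GZSP.IsSPNet.series (GZSP.IsSPNet.edge h31 h3o h1o) hrung ?_ ?_ ?_ ?_
      · rw [Finset.disjoint_singleton_left, Finset.mem_union, Finset.mem_singleton, not_or]
        refine ⟨fun h => hfresh3 _ h (Sym2.mem_mk_left _ _), fun h => ?_⟩
        rw [Sym2.eq_iff] at h
        rcases h with ⟨h, -⟩ | ⟨h, -⟩
        · exact h31 h
        · exact h32 h
      · rintro x ⟨e, he, hxe⟩ ⟨f, hf, hxf⟩
        rw [Finset.mem_singleton] at he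
        subst he
        rcases Sym2.mem_iff.1 hxe with rfl | rfl
        · rw [Finset.mem_union, Finset.mem_singleton] at hf
          rcases hf with hf | rfl
          · exact absurd hxf (hfresh3 f hf)
          · rcases Sym2.mem_iff.1 hxf with h | h
            · exact absurd h h31
            · exact absurd h h32
        · exact Or.inl rfl
      · intro e he hx
        rw [Finset.mem_union, Finset.mem_singleton] at he
        rcases he with he | rfl
        · exact hfresh3 e he hx
        · rcases Sym2.mem_iff.1 hx with h | h
          · exact h31 h
          · exact h32 h
      · intro e he hx
        rw [Finset.mem_singleton] at he
        subst he
        rcases Sym2.mem_iff.1 hx with h | h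
        · exact h32 h.symm
        · exact h12 h.symm
    -- the rail at v
    have hrailv := GZSP.IsSPNet.series hrailu (GZSP.IsSPNet.edge h42.symm h2o h4o) ?_ ?_ ?_ ?_
    · have e34 : 2 * (n + 1) + 1 = 2 * n + 3 := by ring
      have e44 : 2 * (n + 1) + 2 = 2 * n + 4 := by ring
      have eset : ({s(z (2 * n + 3), z (2 * n + 1))} : Finset (Sym2 V)) ∪ (insert s(o, z 0) (L n) ∪ {s(z (2 * n + 1), z (2 * n + 2))})
          ∪ {s(z (2 * n + 2), z (2 * n + 4))} = insert s(o, z 0) (L (n + 1)) := by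
        rw [hLs n, Sym2.eq_swap (a := z (2 * n + 2)) (b := z (2 * n + 4))]
        ext e
        simp only [Finset.mem_union, Finset.mem_insert, Finset.mem_singleton]
        tauto
      rw [e34, e44, ← eset]
      exact hrailv
    · rw [Finset.disjoint_singleton_right, Finset.mem_union, Finset.mem_union, Finset.mem_singleton, Finset.mem_singleton, not_or,
        not_or]
      refine ⟨fun h => ?_, fun h => hfresh4 _ h (Sym2.mem_mk_right _ _), fun h => ?_⟩
      · rw [Sym2.eq_iff] at h
        rcases h with ⟨h, -⟩ | ⟨-, h⟩
        · exact h32 h.symm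
        · exact h43 h
      · rw [Sym2.eq_iff] at h
        rcases h with ⟨-, h⟩ | ⟨-, h⟩
        · exact h42 h
        · have := hz _ _ (by omega) (by omega) h
          omega
    · rintro x ⟨e, he, hxe⟩ ⟨f, hf, hxf⟩
      rw [Finset.mem_singleton] at hf
      subst hf
      rcases Sym2.mem_iff.1 hxf with rfl | rfl
      · exact Or.inl rfl
      · rw [Finset.mem_union, Finset.mem_singleton, Finset.mem_union, Finset.mem_singleton] at he
        rcases he with rfl | he | rfl
        · rcases Sym2.mem_iff.1 hxe with h | h
          · exact absurd h h43
          · have := hz _ _ (by omega) (by omega) h; omega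
        · exact absurd hxe (hfresh4 e he)
        · rcases Sym2.mem_iff.1 hxe with h | h
          · have := hz _ _ (by omega) (by omega) h; omega
          · exact absurd h h42
    · intro e he hx
      rw [Finset.mem_singleton] at he
      subst he
      rcases Sym2.mem_iff.1 hx with h | h
      · exact h32 h
      · exact h43.symm h
    · intro e he hx
      rw [Finset.mem_union, Finset.mem_singleton, Finset.mem_union, Finset.mem_singleton] at he
      rcases he with rfl | he | rfl
      · rcases Sym2.mem_iff.1 hx with h | h
        · exact h43 h
        · have := hz _ _ (by omega) (by omega) h; omega
      · exact hfresh4 e he hx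
      · rcases Sym2.mem_iff.1 hx with h | h
        · have := hz _ _ (by omega) (by omega) h; omega
        · exact h42 h

end Membership

end APL

end Summit.CriticalPhenomena.PercolationContinuityZ3.Theorems
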